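import Summits.QuantumFields.YangMills.Theorems.BalabanUVNodesN13WilsonPartitionFnGaugeFixedLowerBound
import Summits.QuantumFields.YangMills.Theorems.BalabanUVNodesN13NormalisationWindowOfCor3AtRecord13SepCoPHV
import Summits.QuantumFields.YangMills.Theorems.BalabanUVNodesN13UV01LevelZeroAtRecord13

/-!
# BalabanUVNodes ∕ N13 — NO-GO: A COUPLING-BLIND NORMALISATION (`logz`, `Efl` volume-extensive but `g`-independent; e.g. the K0-class `Efl = logz = 0`) CANNOT CARRY
# (B)'s COR-3 CONJUNCT TOGETHER WITH ENDPOINT EXISTENCE — the «numerics question» of p625602 DECIDED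

(Track A, DAG node N13 = [B16]; cluster K1 — K1⁹ `StabilityBRunRowsAtRecordR13SepCoPHV` = stmt-QuantumFields-27364, helper; seat `pub-ymgap-dag-n13-w3` g5; 2026-08-28; count-neutral.)
Second of two files.  p625602 (this seat, g4) proved: (B)'s Cor-3 conjunct at ANY revised Stage-13 datum pins the witness's normalisation `E(P) = EOfRecord₁₃ θ P` to the Wilson free energy
`log Z_{T^{(0)}}(g₀⁻²)` within `ep(g_K)·|T₁^{(K)}|` on every windowed run (`log_partitionFn_sub_E_le_of_cor3With`), and LOCATED the question whether the tree's K0-class witnesses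
(`Node00.Record8Inhabited` :200, `Record12Numerics` :247, `Record12NumericsFamilyDict` :113: `Efl := 0, logz := 0`) can meet that window.  THIS FILE ANSWERS: NO — and more generally no
normalisation whose per-step inputs are COUPLING-BLIND and volume-extensive (`−logz_j·(L⁴−1)|T₁^{(j+1)}| + Efl_j ≤ C_w·|T^{(j)*}|`, one constant `C_w`) can, as soon as endpoint existence holds
(which K1⁹'s own rows (i)(iv)(C) give, K2⁹ by name — the cone-side corollary is the third file).

THE ARGUMENT (elementary).  On a γ-windowed run (`0 < g_j ≤ γ ≤ 1`) with coupling-blind inputs, `E(P) ≤ (15∕4)d(𝔤)|T₁^{(0)}|·log g₀ + 4(|log σ₀| + C_w)|T₁^{(0)}|` (§1: only the scale-0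
logarithm is kept, `|T^{(0)*}| = 4(1 − L⁻⁴)|T₁^{(0)}| ≥ (15∕4)|T₁^{(0)}|`), i.e. `−E ≥ (15∕8)d(𝔤)|T₁^{(0)}| log β₀ − O(|T₁^{(0)}|)`; the first file gives `log Z ≥ −(7∕4)d(𝔤)|T₁^{(0)}| log β₀ − O(|T₁^{(0)}|)`;
the window `log Z − E ≤ ep(g_K)·(2L^m)⁴` then forces `(1∕8)d(𝔤)|T₁^{(0)}(K)|·log β₀ ≤ C|T₁^{(0)}(K)| + ep(g_K)(2L^m)⁴`.  Along END's runs (`DagBinding.EndpointExistence`: every `K`, FIXED endpoint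
`g_K = g`, all couplings `≤ γ`) with `γ ≤ γ_* = exp(−4C∕d(𝔤))` this reads `|T₁^{(0)}(K)| = (2L^m)⁴L^{4K} ≤ ep(g)·(2L^m)⁴` for EVERY `K` — absurd.  What a genuine witness must carry instead is
print's `log z_j ≈ d(𝔤) log g_j` ([I] (0.15); tree `B16ZLower.log_zNorm_specialUnitaryGroup_ge`), which lowers `−E`'s coefficient to `(3∕2)d(𝔤)` = the Gaussian one.

WHAT IS PROVED (0 `sorry`, 0 `def`; [folklore] real arithmetic over landed definitions + the two cited theorems):
* §1 `EOfRecord₁₃_le_of_couplingBlind` (any `N`, any Stage-13 parameter, any windowed run with `K ≥ 1`).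
* §2 ★★★ `false_of_endStatementBPrinted_of_endpointExistence_of_couplingBlind` (`N ≥ 2`, every `θ h v`, every `C_w ≥ 0`):
  `B16.EndStatementBPrinted (datumOfRecord₁₃SepCoPHV F N θ h v).C → DagBinding.EndpointExistence (datumOfRecord₁₃SepCoPHV F N θ h v).C.toB12 → False`;
  `not_endStatementBPrinted_and_endpointExistence_of_logz_zero_Efl_zero` (the K0-class reading `θ.logz = 0 ∧ θ.Efl = 0`).
HONEST FRAMING: count-neutral; nothing of Bałaban's asserted or refuted — the theorem concerns the TREE's coupling-blind normalisation slots, not print's `E`; K1⁹ NEITHER proved NOR refuted (its `∃ θ`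
is untouched; only the coupling-blind witness class is excluded); no skeleton ∕ route text changed; N13 NOT discharged; counts UNMOVED (typed 28∕28 · discharged 5∕27 · A 5∕28); R4 closes the
conditional finite-𝕋⁴ rung `BalabanLadder.UV` only — the Yang–Mills mass gap (Clay) is NOT proved by any of this; nothing continuum ∕ ℝ⁴ ∕ OS.  No `sorry`, `def`, `instance`, `notation`.
-/

noncomputable section

open MeasureTheory
open scoped BigOperators

namespace Summit.QuantumFields.YangMills.BalabanUVNodes.N13NormalisationNoGoCouplingBlindAtRecord13SepCoPHV

open Literature.MathematicalPhysics.QuantumFieldTheory.Balaban1983to89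
open Literature.MathematicalPhysics.QuantumFieldTheory.Balaban1983to89.T4Continuum
open Literature.MathematicalPhysics.QuantumFieldTheory.Balaban1983to89.Node00
open Literature.MathematicalPhysics.QuantumFieldTheory.Balaban1983to89.FlowStepRuns (genSeq genSeq_zero)
open Missing
open Summit.QuantumFields.YangMills.BalabanUVNodes.N13UV01LevelZeroAtRecord13 (tstarCount_P_nonneg sum_tstarCount_P_range_le)
open Summit.QuantumFields.YangMills.BalabanUVNodes.N13WilsonPartitionFnGaugeFixedLowerBound (log_partitionFn_ge_gaugeFixed_specialUnitary_d4)
open Summit.QuantumFields.YangMills.BalabanUVNodes.N13NormalisationWindowOfCor3AtRecord13SepCoPHV (log_partitionFn_sub_E_le_of_cor3With)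

variable {F : T4Family} {N : ℕ} [NeZero N]

/-! ## §1. The normalisation of a coupling-blind witness along a windowed run: only the scale-0 logarithm survives, with the bond count `|T^{(0)*}| ≥ (15∕4)|T₁^{(0)}|` -/

section EBound

variable (θ : Stage13Params F N) (P : B12.RunParams)

/-- `|T₁^{(0)}| = L⁴·|T₁^{(1)}|` in the standing range, hence `|T^{(0)*}| = 4(|T₁^{(0)}| − |T₁^{(1)}|) ≥ (15∕4)·|T₁^{(0)}|` (`L ≥ 2`). [cite: Balaban1988Convergent, (1.15) p.249 (bookkeeping)] -/
theorem tstarCount_zero_ge (K : ℕ) (hK : 1 ≤ K) : 15 / 4 * (Fintype.card (Site (F.P K) 0) : ℝ) ≤ tstarCount (F.P K) 0 := by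
  unfold tstarCount sitesCard
  have h := Site.card_site_eq_mul_succ (P := F.P K) (j := 0) (by simp; omega)
  have hL2 : 2 ≤ F.L := F.hL.2
  have hL16 : 16 ≤ (F.P K).L ^ (F.P K).d := by
    have : (F.P K).L ^ (F.P K).d = F.L ^ 4 := by simp
    rw [this]
    calc 16 = 2 ^ 4 := by norm_num
      _ ≤ F.L ^ 4 := Nat.pow_le_pow_left hL2 4
  have hle : 16 * Fintype.card (Site (F.P K) (0 + 1)) ≤ Fintype.card (Site (F.P K) 0) := by
    rw [h]; exact Nat.mul_le_mul_right _ hL16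
  have hleR : 16 * (Fintype.card (Site (F.P K) (0 + 1)) : ℝ) ≤ Fintype.card (Site (F.P K) 0) := by exact_mod_cast hle
  simp only [Nat.zero_add] at hleR ⊢
  linarith

/-- **`E(P)` OF A COUPLING-BLIND WITNESS ALONG A γ-WINDOWED RUN** (`K ≥ 1`, `0 < g_j ≤ γ ≤ 1` for `j ≤ K`): if the per-step normalisation inputs satisfy
`−logz_j·(L⁴−1)|T₁^{(j+1)}| + Efl_j ≤ C_w·|T^{(j)*}|` for `j < K` (one constant `C_w ≥ 0`; the K0-class `Efl = logz = 0` is `C_w = 0`), then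
`E(P) ≤ (15∕4)·d(𝔤)·|T₁^{(0)}|·log g₀ + 4(|log σ₀| + C_w)·|T₁^{(0)}|` — every scale-`j ≥ 1` logarithm is dropped (`log g_j ≤ 0`), the scale-0 one is kept with `|T^{(0)*}| ≥ (15∕4)|T₁^{(0)}|`.
[cite: Balaban1988Convergent, (1.15) p.249, Thm 1 p.262 (the shape of `E`; bookkeeping)] -/
theorem EOfRecord₁₃_le_of_couplingBlind {Cw : ℝ} (hCw : 0 ≤ Cw)
    (hw : ∀ j, j < P.K → -(θ.logz P j) * ((((F.P P.K).L : ℝ) ^ 4 - 1) * sitesCard (F.P P.K) (j + 1)) + θ.Efl P j ≤ Cw * tstarCount (F.P P.K) j)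
    (hK : 1 ≤ P.K) {γ : ℝ} (hγ : γ ≤ 1) (hI : ∀ k, k ≤ P.K → 0 < gOfRecord₁₃ F N θ P k ∧ gOfRecord₁₃ F N θ P k ≤ γ) :
    EOfRecord₁₃ F N θ P ≤ 15 / 4 * ((dimSU N : ℕ) : ℝ) * (Fintype.card (Site (F.P P.K) 0) : ℝ) * Real.log P.g0
      + 4 * (|θ.ν.logσ₀| + Cw) * (Fintype.card (Site (F.P P.K) 0) : ℝ) := by
  have hE : EOfRecord₁₃ F N θ P = ∑ j ∈ Finset.range P.K, eStepOfRecord N θ.ν (θ.Efl P) (θ.logz P) (gOfRecord₁₃ F N θ P) (F.P P.K) j := rfl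
  have hd : (0 : ℝ) ≤ ((dimSU N : ℕ) : ℝ) := Nat.cast_nonneg _
  have hstep : ∀ j ∈ Finset.range P.K, eStepOfRecord N θ.ν (θ.Efl P) (θ.logz P) (gOfRecord₁₃ F N θ P) (F.P P.K) j ≤
      (if j = 0 then Real.log P.g0 * ((dimSU N : ℕ) : ℝ) * tstarCount (F.P P.K) 0 else 0) + (|θ.ν.logσ₀| + Cw) * tstarCount (F.P P.K) j := by
    intro j hj
    have hjK : j < P.K := Finset.mem_range.mp hj
    have hg := hI j hjK.le
    have hlog : Real.log (gOfRecord₁₃ F N θ P j) ≤ 0 := Real.log_nonpos hg.1.le (hg.2.trans hγ)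
    have hT : 0 ≤ tstarCount (F.P P.K) j := tstarCount_P_nonneg (F := F) (by simp; omega)
    have hwj := hw j hjK
    have hσ : θ.ν.logσ₀ * tstarCount (F.P P.K) j ≤ |θ.ν.logσ₀| * tstarCount (F.P P.K) j :=
      mul_le_mul_of_nonneg_right (le_abs_self _) hT
    unfold eStepOfRecord
    by_cases hj0 : j = 0
    · subst hj0
      have hg0 : gOfRecord₁₃ F N θ P 0 = P.g0 := genSeq_zero _ _
      rw [if_pos rfl, hg0]
      nlinarith
    · rw [if_neg hj0]
      have hneg : Real.log (gOfRecord₁₃ F N θ P j) * ((dimSU N : ℕ) : ℝ) * tstarCount (F.P P.K) j ≤ 0 :=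
        mul_nonpos_of_nonpos_of_nonneg (mul_nonpos_of_nonpos_of_nonneg hlog hd) hT
      nlinarith
  rw [hE]
  refine (Finset.sum_le_sum hstep).trans ?_
  rw [Finset.sum_add_distrib, Finset.sum_ite_eq' (Finset.range P.K) 0, if_pos (Finset.mem_range.mpr hK), ← Finset.mul_sum]
  have hsum : (|θ.ν.logσ₀| + Cw) * ∑ j ∈ Finset.range P.K, tstarCount (F.P P.K) j ≤ (|θ.ν.logσ₀| + Cw) * (4 * (Fintype.card (Site (F.P P.K) 0) : ℝ)) :=
    mul_le_mul_of_nonneg_left (sum_tstarCount_P_range_le (F := F) P.K P.K) (by positivity)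
  have hlog0 : Real.log P.g0 ≤ 0 := by
    have hg := hI 0 (Nat.zero_le _)
    rw [show gOfRecord₁₃ F N θ P 0 = P.g0 from genSeq_zero _ _] at hg
    exact Real.log_nonpos hg.1.le (hg.2.trans hγ)
  have h0 : Real.log P.g0 * ((dimSU N : ℕ) : ℝ) * tstarCount (F.P P.K) 0 ≤
      Real.log P.g0 * ((dimSU N : ℕ) : ℝ) * (15 / 4 * (Fintype.card (Site (F.P P.K) 0) : ℝ)) :=
    mul_le_mul_of_nonpos_left (tstarCount_zero_ge P.K hK) (mul_nonpos_of_nonpos_of_nonneg hlog0 hd)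
  nlinarith [hsum, h0]

end EBound

/-! ## §2. The no-go: (B) at a revised record datum + endpoint existence ⟹ `False` for every coupling-blind witness (`N ≥ 2`) -/

section NoGo

variable (θ : Stage13HParams F N) (h : θ.Provisos₁₃SepCoPH F N) (v : Revision₁₃ F N θ h)

/-- `d(𝔰𝔲(N)) = N² − 1` as a real number. [folklore] -/
theorem dimSU_cast : ((dimSU N : ℕ) : ℝ) = ((N * N : ℕ) : ℝ) - 1 := by
  have hN1 : 1 ≤ N := Nat.pos_of_ne_zero (NeZero.ne N)
  have h1 : 1 ≤ N ^ 2 := Nat.one_le_pow _ _ hN1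
  unfold dimSU
  rw [Nat.cast_sub h1, sq]
  simp

/-- `d(𝔰𝔲(N)) ≥ 3` for `N ≥ 2`. [folklore] -/
theorem three_le_dimSU (hN : 2 ≤ N) : (3 : ℝ) ≤ ((dimSU N : ℕ) : ℝ) := by
  rw [dimSU_cast]
  have : (4 : ℝ) ≤ ((N * N : ℕ) : ℝ) := by exact_mod_cast Nat.mul_le_mul hN hN
  linarith

/-- The site counts of the run `⟨K, m, g₀⟩`: `|T₁^{(K)}| = (2L^m)⁴` (the construction's `numSites K`) and `|T₁^{(0)}| = (2L^m)⁴·L^{4K}`. [cite: Balaban1987RG1, (0.1) p.251 (bookkeeping)] -/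
theorem card_site_zero_eq (K : ℕ) :
    (Fintype.card (Site (F.P K) 0) : ℝ) = (Fintype.card (Site (F.P K) K) : ℝ) * ((F.L : ℝ) ^ K) ^ 4 := by
  have h0 : Fintype.card (Site (F.P K) 0) = (2 * F.L ^ (F.m + K)) ^ 4 := by
    rw [Site.card_site]; simp [Params.sitesPerDir]
  have hK : Fintype.card (Site (F.P K) K) = (2 * F.L ^ F.m) ^ 4 := by
    rw [Site.card_site]; simp [Params.sitesPerDir]
  rw [h0, hK]; push_cast; ring

/-- The unit lattice is not empty: `0 < |T₁^{(K)}|`. [folklore] -/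
theorem card_site_top_pos (K : ℕ) : (0 : ℝ) < (Fintype.card (Site (F.P K) K) : ℝ) := by
  exact_mod_cast Fintype.card_pos

/-- `L^{4K} ≥ K` (`L ≥ 2`). [folklore] -/
theorem le_L_pow (K : ℕ) : (K : ℝ) ≤ ((F.L : ℝ) ^ K) ^ 4 := by
  have hL2 : 2 ≤ F.L := F.hL.2
  have h1 : K < 2 ^ K := Nat.lt_two_pow_self
  have h2 : 2 ^ K ≤ F.L ^ K := Nat.pow_le_pow_left hL2 K
  have h3 : F.L ^ K ≤ (F.L ^ K) ^ 4 := by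
    calc F.L ^ K = (F.L ^ K) ^ 1 := (pow_one _).symm
      _ ≤ (F.L ^ K) ^ 4 := Nat.pow_le_pow_right (Nat.one_le_pow _ _ (by omega)) (by norm_num)
  have : K ≤ (F.L ^ K) ^ 4 := by omega
  exact_mod_cast this

/-- **★★★ THE NO-GO.**  `N ≥ 2`; `θ h v` ANY Stage-13 tuple, provisos and revision; the normalisation inputs COUPLING-BLIND and volume-extensive with one constant `C_w ≥ 0`:
`∀ p j, j < p.K → −logz_p(j)·(L⁴−1)|T₁^{(j+1)}| + Efl_p(j) ≤ C_w·|T^{(j)*}|`.  Then (B) at the revised datum and endpoint existence of its (version-free) small-field part are JOINTLY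
CONTRADICTORY.  Proof: (B) ⟹ the log-window `log Z_K(g₀⁻²) − E(P) ≤ ep(g_K)·|T₁^{(K)}|` on every windowed run (p625602); END supplies, for `γ ≤ γ_*`, a target `g` and for EVERY `K` a run
`⟨K, m, g₀(K)⟩` in the γ-window ending at `g`; on it §1 bounds `E` above and the first file bounds `log Z` below; the three give `|T₁^{(0)}(K)| ≤ ep(g)·|T₁^{(K)}|`, i.e. `L^{4K} ≤ ep(g)` for all `K`.
NOTHING of Bałaban's refuted: the excluded class is the tree's coupling-blind normalisation slot. [cite: Balaban1988Convergent, Thm 1 p.262, (1.15) p.249, Cor. 3 (2.50) p.264; Balaban1987RG1, Thm 2 p.259, (0.15) p.254] -/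
theorem false_of_endStatementBPrinted_of_endpointExistence_of_couplingBlind (hN : 2 ≤ N) {Cw : ℝ} (hCw : 0 ≤ Cw)
    (hw : ∀ (p : B12.RunParams) (j : ℕ), j < p.K →
      -(θ.logz p j) * ((((F.P p.K).L : ℝ) ^ 4 - 1) * sitesCard (F.P p.K) (j + 1)) + θ.Efl p j ≤ Cw * tstarCount (F.P p.K) j)
    (hB : B16.EndStatementBPrinted (datumOfRecord₁₃SepCoPHV F N θ h v).C)
    (hE : DagBinding.EndpointExistence (datumOfRecord₁₃SepCoPHV F N θ h v).C.toB12) : False := by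
  obtain ⟨-, γB, hγB, em, ep, hcor⟩ := hB
  obtain ⟨γ₂, hγ₂, hend⟩ := hE F.m
  -- constants
  set d : ℝ := ((dimSU N : ℕ) : ℝ) with hddef
  have hd3 : 3 ≤ d := three_le_dimSU hN
  have hdpos : 0 < d := by linarith
  set CN : ℝ := ((N * N : ℕ) : ℝ) * Real.log (16 * Real.pi + 1) + Real.log ((2 * N + 1) / (4 * Real.pi)) with hCN
  set C : ℝ := |128 + 7 / 2 * CN| + 4 * (|θ.ν.logσ₀| + Cw) + 1 with hCdef
  have hCpos : 0 < C := by positivity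
  -- the window γ
  set γ : ℝ := min (min γB γ₂) (min 1 (Real.exp (-(4 * C / d)))) with hγdef
  have hγpos : 0 < γ := lt_min (lt_min hγB hγ₂) (lt_min one_pos (Real.exp_pos _))
  have hγB' : γ ≤ γB := (min_le_left _ _).trans (min_le_left _ _)
  have hγ₂' : γ ≤ γ₂ := (min_le_left _ _).trans (min_le_right _ _)
  have hγ1 : γ ≤ 1 := (min_le_right _ _).trans (min_le_left _ _)
  have hγexp : γ ≤ Real.exp (-(4 * C / d)) := (min_le_right _ _).trans (min_le_right _ _)
  -- endpoint existence at this γ: a target `g` and, for every `K`, a run in the window ending at `g`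
  obtain ⟨g, hgpos, hruns⟩ := hend γ hγpos hγ₂'
  have hrun : ∀ K : ℕ, ∃ g0 : ℝ, ((datumOfRecord₁₃SepCoPHV F N θ h v).C ⟨K, F.m, g0⟩).flow.InInterval γ K ∧
      ((datumOfRecord₁₃SepCoPHV F N θ h v).C ⟨K, F.m, g0⟩).flow.g K = g := fun K => by
    obtain ⟨g0, h1, h2⟩ := hruns g hgpos le_rfl K
    exact ⟨g0, h1, h2⟩
  -- the per-`K` inequality `|T₁^{(0)}(K)| ≤ ep(g)·|T₁^{(K)}|`
  have hkey : ∀ K : ℕ, 1 ≤ K → (Fintype.card (Site (F.P K) 0) : ℝ) ≤ ep g * (Fintype.card (Site (F.P K) K) : ℝ) := by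
    intro K hK
    obtain ⟨g0, hI, hgK⟩ := hrun K
    -- (B): the log-window on this run
    have hwin := log_partitionFn_sub_E_le_of_cor3With F N θ h v hcor K g0 (fun k hk => ⟨(hI k hk).1, (hI k hk).2.trans hγB'⟩)
    have hnum : ((datumOfRecord₁₃SepCoPHV F N θ h v).C ⟨K, F.m, g0⟩).numSites K = Fintype.card (Site (F.P K) K) := rfl
    rw [hgK, hnum] at hwin
    -- the couplings of the run: `g_k = gOfRecord₁₃ θ ⟨K, m, g₀⟩ k`, `g_0 = g₀ ∈ (0, γ]`
    have hflow : ((datumOfRecord₁₃SepCoPHV F N θ h v).C ⟨K, F.m, g0⟩).flow.g = gOfRecord₁₃ F N θ.toStage13Params ⟨K, F.m, g0⟩ :=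
      flow_g_datumOfRecord₁₃SepCoPHV F N θ h v ⟨K, F.m, g0⟩
    have hI' : ∀ k, k ≤ K → 0 < gOfRecord₁₃ F N θ.toStage13Params ⟨K, F.m, g0⟩ k ∧ gOfRecord₁₃ F N θ.toStage13Params ⟨K, F.m, g0⟩ k ≤ γ :=
      fun k hk => by have := hI k hk; rwa [hflow] at this
    have hg0 : 0 < g0 ∧ g0 ≤ γ := by
      have := hI' 0 (Nat.zero_le _)
      rwa [show gOfRecord₁₃ F N θ.toStage13Params ⟨K, F.m, g0⟩ 0 = g0 from genSeq_zero _ _] at this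
    -- §1: `E` above
    have hEle := EOfRecord₁₃_le_of_couplingBlind (F := F) θ.toStage13Params ⟨K, F.m, g0⟩ hCw (fun j hj => hw ⟨K, F.m, g0⟩ j hj) hK hγ1 hI'
    dsimp only at hEle
    -- first file: `log Z` below at `β₀ = g₀⁻² ≥ 1`
    have hβ : 1 ≤ g0⁻¹ ^ 2 := by
      have h1 : 1 ≤ g0⁻¹ := (one_le_inv₀ hg0.1).2 (hg0.2.trans hγ1)
      nlinarith
    have hZ := log_partitionFn_ge_gaugeFixed_specialUnitary_d4 N (F.P K) (T4Family.P_d F K) hβ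
    rw [← dimSU_cast (N := N)] at hZ
    rw [← hddef] at hEle hZ
    rw [← hCN] at hZ
    -- `log β₀ = −2 log g₀`, `log g₀ ≤ log γ ≤ −4C/d`
    have hlogβ : Real.log (g0⁻¹ ^ 2) = -2 * Real.log g0 := by rw [Real.log_pow, Real.log_inv]; ring
    rw [hlogβ] at hZ
    have hlogg0 : Real.log g0 ≤ -(4 * C / d) := by
      have h1 : Real.log g0 ≤ Real.log γ := Real.log_le_log hg0.1 hg0.2
      have h2 : Real.log γ ≤ -(4 * C / d) := by
        have := Real.log_le_log hγpos hγexp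
        rwa [Real.log_exp] at this
      linarith
    -- atoms: `T0 = |T₁^{(0)}|`, `nK = |T₁^{(K)}|`, `X = log g₀`
    set T0 : ℝ := (Fintype.card (Site (F.P K) 0) : ℝ) with hT0
    set nK : ℝ := (Fintype.card (Site (F.P K) K) : ℝ) with hnK
    set X : ℝ := Real.log g0 with hX
    have hT0nn : 0 ≤ T0 := Nat.cast_nonneg _
    -- `log Z ≤ E + ep g·nK ≤ 15/4·d·T0·X + 4(|logσ₀| + Cw)·T0 + ep g·nK` and `7/2·d·T0·X − C₁·T0 ≤ log Z`
    have h1 : Real.log (partitionFn (G := SU N) (F.P K) (g0⁻¹ ^ 2)) ≤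
        15 / 4 * d * T0 * X + 4 * (|θ.ν.logσ₀| + Cw) * T0 + ep g * nK := by linarith [hwin, hEle]
    have hcomb : -(7 / 4 * d) * T0 * (-2 * X) - (128 + 7 / 2 * CN) * T0 ≤
        15 / 4 * d * T0 * X + 4 * (|θ.ν.logσ₀| + Cw) * T0 + ep g * nK := le_trans hZ h1
    -- hence `(1/4)·(−d·T0·X) ≤ (C₁ + 4(|logσ₀|+Cw))·T0 + ep g·nK`, while `−d·T0·X ≥ 4C·T0`
    have hWle : 4 * C * T0 ≤ d * T0 * (-X) := by
      have h1 : 4 * C / d ≤ -X := by linarith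
      have h2 : d * T0 * (4 * C / d) ≤ d * T0 * (-X) := mul_le_mul_of_nonneg_left h1 (mul_nonneg hdpos.le hT0nn)
      have h3 : d * T0 * (4 * C / d) = 4 * C * T0 := by field_simp
      linarith
    have habs' : (128 + 7 / 2 * CN) * T0 ≤ |128 + 7 / 2 * CN| * T0 := mul_le_mul_of_nonneg_right (le_abs_self _) hT0nn
    have e1 : -(7 / 4 * d) * T0 * (-2 * X) = -(7 / 2) * (d * T0 * (-X)) := by ring
    have e2 : 15 / 4 * d * T0 * X = -(15 / 4) * (d * T0 * (-X)) := by ring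
    rw [e1, e2] at hcomb
    rw [hCdef] at hWle
    linarith [hcomb, hWle, habs', hT0nn]
  -- choose `K` with `L^{4K} > ep(g)`
  obtain ⟨K, hK1, hKbig⟩ : ∃ K : ℕ, 1 ≤ K ∧ ep g < (K : ℝ) := by
    refine ⟨⌈ep g⌉₊ + 1, by omega, ?_⟩
    have := Nat.le_ceil (ep g)
    push_cast
    linarith
  have h1 := hkey K hK1
  rw [card_site_zero_eq (F := F) K] at h1
  have hn := card_site_top_pos (F := F) K
  have hL := le_L_pow (F := F) K
  -- `nK·L^{4K} ≤ ep g·nK < K·nK ≤ L^{4K}·nK`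
  have : (Fintype.card (Site (F.P K) K) : ℝ) * ((F.L : ℝ) ^ K) ^ 4 < (Fintype.card (Site (F.P K) K) : ℝ) * ((F.L : ℝ) ^ K) ^ 4 :=
    calc (Fintype.card (Site (F.P K) K) : ℝ) * ((F.L : ℝ) ^ K) ^ 4 ≤ ep g * (Fintype.card (Site (F.P K) K) : ℝ) := h1
      _ < (K : ℝ) * (Fintype.card (Site (F.P K) K) : ℝ) := mul_lt_mul_of_pos_right hKbig hn
      _ ≤ ((F.L : ℝ) ^ K) ^ 4 * (Fintype.card (Site (F.P K) K) : ℝ) := mul_le_mul_of_nonneg_right hL hn.le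
      _ = (Fintype.card (Site (F.P K) K) : ℝ) * ((F.L : ℝ) ^ K) ^ 4 := mul_comm _ _
  exact lt_irrefl _ this

/-- **★★ THE K0-CLASS READING `Efl = logz = 0` IS EXCLUDED** (`N ≥ 2`): at ANY Stage-13 tuple whose normalisation inputs vanish (`θ.logz = 0`, `θ.Efl = 0` — the reading of
`Node00.Record8Inhabited` ∕ `Record12Numerics` ∕ `Record12NumericsFamilyDict`), (B) at the revised datum (any slot `v`) and endpoint existence cannot both hold.
[cite: Balaban1988Convergent, Thm 1 p.262, (1.15) p.249, Cor. 3 (2.50) p.264; Balaban1987RG1, Thm 2 p.259] -/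
theorem not_endStatementBPrinted_and_endpointExistence_of_logz_zero_Efl_zero (hN : 2 ≤ N)
    (hz : ∀ p j, θ.logz p j = 0) (hEfl : ∀ p j, θ.Efl p j = 0) :
    ¬ (B16.EndStatementBPrinted (datumOfRecord₁₃SepCoPHV F N θ h v).C ∧ DagBinding.EndpointExistence (datumOfRecord₁₃SepCoPHV F N θ h v).C.toB12) := by
  rintro ⟨hB, hE⟩
  refine false_of_endStatementBPrinted_of_endpointExistence_of_couplingBlind θ h v hN (Cw := 0) le_rfl (fun p j hj => ?_) hB hE
  rw [hz, hEfl, neg_zero, zero_mul, zero_add, zero_mul]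

/-- The same at the UNREVISED record datum (slot `v := Revision₁₃.refl`; `datumOfRecord₁₃SepCoPHV_refl`). [cite: Balaban1988Convergent, Thm 1 p.262, Cor. 3 (2.50) p.264 (bookkeeping)] -/
theorem not_endStatementBPrinted_and_endpointExistence_record_of_logz_zero_Efl_zero (hN : 2 ≤ N)
    (hz : ∀ p j, θ.logz p j = 0) (hEfl : ∀ p j, θ.Efl p j = 0) :
    ¬ (B16.EndStatementBPrinted (datumOfRecord₁₃SepCoPH F N θ h).C ∧ DagBinding.EndpointExistence (datumOfRecord₁₃SepCoPH F N θ h).C.toB12) := by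
  have := not_endStatementBPrinted_and_endpointExistence_of_logz_zero_Efl_zero θ h (Revision₁₃.refl F N θ h) hN hz hEfl
  rwa [datumOfRecord₁₃SepCoPHV_refl] at this

end NoGo

end Summit.QuantumFields.YangMills.BalabanUVNodes.N13NormalisationNoGoCouplingBlindAtRecord13SepCoPHV

end
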